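import Summits.NavierStokesRegularity.NavierStokesRegularity.Theses.TypeILiouville
import Literature.Analysis.FluidPDE.LocalTypeI
import HarnessLib

/-!
# Strategist sketch — crux `TypeIliouvilleNoTypeII` (stmt-NavierStokesRegularity-0056)

Typed objects behind `STRATEGY-CENSUS.md` (crux-strategist pass s1, 2026-08-17).  Nothing here
is a line or a stub: these are the STRENGTHENINGS (S1, S3) and the DECOMPOSITION (D4) that the
census examines and rejects, stated over existing declarations so that "rejected" is a statement
about precise Props and not about prose.  Every glue theorem is proved (no `sorry`).
-/

noncomputable section

set_option linter.dupNamespace false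

open Set Filter Topology MeasureTheory Metric
open scoped ENNReal

namespace Summit.NavierStokesRegularity.NavierStokesRegularity.Cruxes.TypeIliouvilleNoTypeII.Strategist

open Literature.Analysis.FluidPDE
open Summit.NavierStokesRegularity.NavierStokesRegularity.Theses.TypeILiouville

local notation "E3" => EuclideanSpace ℝ (Fin 3)

/-! ## Strengthen S1 — a UNIFORM Type-I constant -/

/-- **S1 (uniform constant).**  There is ONE dimensionless `K` such that every maximal
Leray–Hopf solution from a rapidly decaying datum obeys `‖u(t)‖_∞ ≤ K √ν / √(T - t)` near `T`
(the dimensionless excess `√((T-t)/ν) ‖u(t)‖_∞` is eventually `≤ K`, uniformly in the solution). -/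
def UniformTypeIConstant : Prop :=
  ∃ K : ℝ, ∀ (ν T : ℝ), 0 < ν → 0 < T → ∀ (u : ℝ → E3 → E3) (p : ℝ → E3 → ℝ),
    IsMaximalSmoothSolution ν 0 u p T → IsLerayHopfOn T ν 0 (u 0) u →
    HasRapidSpatialDecay (u 0) →
    ∀ᶠ t in 𝓝[<] T, ∀ x, ‖u t x‖ ≤ K * Real.sqrt ν / Real.sqrt (T - t)

/-- S1 is formally stronger than the crux (take `C := K √ν`). [folklore] -/
theorem noTypeII_of_uniformTypeIConstant (h : UniformTypeIConstant) : TypeIliouvilleNoTypeII := by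
  obtain ⟨K, hK⟩ := h
  intro ν T hν hT u p hmax hLH hdec
  exact ⟨K * Real.sqrt ν, hK ν T hν hT u p hmax hLH hdec⟩

/-! ## Strengthen S3 — Type I in BOTH the sup-norm and a critical (weak-`L³`) sense -/

/-- **S3 (critical Type I on top of the rate).**  Every maximal Leray–Hopf solution from a rapidly
decaying datum is Type I in the sup-norm sense AND keeps a uniformly bounded weak-`L³` profile up to
the blow-up time (`λ³ · |{‖u(t)‖ > λ}| ≤ M`), i.e. it is Type I in the sense of
Barker–Prange (arXiv:2003.06717, `‖u‖_{L^∞_t L^{3,∞}_x} ≤ M`) as well. -/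
def CriticalTypeI : Prop :=
  ∀ (ν T : ℝ), 0 < ν → 0 < T → ∀ (u : ℝ → E3 → E3) (p : ℝ → E3 → ℝ),
    IsMaximalSmoothSolution ν 0 u p T → IsLerayHopfOn T ν 0 (u 0) u →
    HasRapidSpatialDecay (u 0) →
    IsTypeIBlowup u T ∧
      ∃ M : ℝ≥0∞, M < ⊤ ∧ ∀ t ∈ Ico 0 T, ∀ lam : ℝ, 0 < lam →
        ENNReal.ofReal (lam ^ 3) * volume {x : E3 | lam < ‖u t x‖} ≤ M

/-- S3 is formally stronger than the crux (first conjunct). [folklore] -/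
theorem noTypeII_of_criticalTypeI (h : CriticalTypeI) : TypeIliouvilleNoTypeII :=
  fun ν T hν hT u p hmax hLH hdec => (h ν T hν hT u p hmax hLH hdec).1

/-! ## Decomposition D4 — split at the ENERGY notion of Type I (Seregin / Albritton–Barker) -/

/-- **D4a (no energy-Type-II singularity).**  At the blow-up time of a maximal Leray–Hopf solution
from a rapidly decaying datum, every space point carries a backward parabolic ball on which
Albritton–Barker's scale-invariant quantity `𝐈 = sup_{Q' ⊂ Q} (A + C + D + E)(Q')` is finite
(`typeIBound`, `Literature/Analysis/FluidPDE/LocalTypeI.lean`): no singular point is of Type II in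
the energy sense of Seregin (arXiv:2606.29468 §1: `g₀(v) = ∞`). -/
def NoEnergyTypeIISingularity : Prop :=
  ∀ (ν T : ℝ), 0 < ν → 0 < T → ∀ (u : ℝ → E3 → E3) (p : ℝ → E3 → ℝ),
    IsMaximalSmoothSolution ν 0 u p T → IsLerayHopfOn T ν 0 (u 0) u →
    HasRapidSpatialDecay (u 0) →
    ∀ x : E3, ∃ r : ℝ, 0 < r ∧
      typeIBound (parabolicCylinder r (T, x)) u p (fun t y => fderiv ℝ (u t) y) < ⊤

/-- **D4b (energy-Type-I points have the sup-norm Type-I rate).**  If every point at the blow-up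
time is energy-Type-I (conclusion of D4a), the solution blows up at the sup-norm Type I rate. -/
def EnergyTypeIGivesRate : Prop :=
  ∀ (ν T : ℝ), 0 < ν → 0 < T → ∀ (u : ℝ → E3 → E3) (p : ℝ → E3 → ℝ),
    IsMaximalSmoothSolution ν 0 u p T → IsLerayHopfOn T ν 0 (u 0) u →
    HasRapidSpatialDecay (u 0) →
    (∀ x : E3, ∃ r : ℝ, 0 < r ∧
      typeIBound (parabolicCylinder r (T, x)) u p (fun t y => fderiv ℝ (u t) y) < ⊤) →
    IsTypeIBlowup u T

/-- The D4 glue: `D4a → D4b → crux` (pure logic). [folklore] -/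
theorem noTypeII_of_energySplit (ha : NoEnergyTypeIISingularity) (hb : EnergyTypeIGivesRate) :
    TypeIliouvilleNoTypeII :=
  fun ν T hν hT u p hmax hLH hdec =>
    hb ν T hν hT u p hmax hLH hdec (ha ν T hν hT u p hmax hLH hdec)

/-- … and D4b is NECESSARY as soon as the crux holds (it is an instance of it), so under D4a the
piece D4b is the crux again — the split does not shrink the crux (census §Decomposition). [folklore] -/
theorem energyTypeIGivesRate_of_noTypeII (h : TypeIliouvilleNoTypeII) : EnergyTypeIGivesRate :=
  fun ν T hν hT u p hmax hLH hdec _ => h ν T hν hT u p hmax hLH hdec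


/-! ## D4′ — where the energy pivot DOES bite: at route level (recorded for tenure; not this seat's edit)

The energy dichotomy splits `NoBlowup` (the thesis X of every consumer) rather than the crux:
X ⇐ D4a ∧ D4c with D4c the ENERGY form of Type-I exclusion.  For Liouville-type consumers D4c is
what their mechanism already yields ((L) ⇒ ¬`LocalTypeISingularityExists` modulo
`AlbrittonBarkerForward` and class bookkeeping), so such a route may borrow the WEAKER D4a instead of
the sup-rate `NoTypeII` (NoTypeII ⇒ D4a is the Albritton–Barker Lemma 2.4 bookkeeping already used in
stmt-10662; D4a ⇏ NoTypeII is D4b, open). -/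

/-- **D4c (energy form of Type-I exclusion).**  A maximal Leray–Hopf solution from a rapidly decaying
datum cannot have ALL its blow-up-time points energy-Type-I. -/
def NoEnergyTypeISingularityAtBlowup : Prop :=
  ∀ (ν T : ℝ), 0 < ν → 0 < T → ∀ (u : ℝ → E3 → E3) (p : ℝ → E3 → ℝ),
    IsMaximalSmoothSolution ν 0 u p T → IsLerayHopfOn T ν 0 (u 0) u →
    HasRapidSpatialDecay (u 0) →
    ¬ (∀ x : E3, ∃ r : ℝ, 0 < r ∧
      typeIBound (parabolicCylinder r (T, x)) u p (fun t y => fderiv ℝ (u t) y) < ⊤)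

/-- The energy dichotomy decides the THESIS X (= `NoBlowup`) directly: D4a ∧ D4c ⇒ X. [folklore] -/
theorem thesis_of_energyDichotomy (ha : NoEnergyTypeIISingularity)
    (hc : NoEnergyTypeISingularityAtBlowup) : TypeIliouvilleThesis := by
  intro ν T hν hT u p hcl hLH hdec
  by_contra hext
  exact hc ν T hν hT u p ⟨hcl, hext⟩ hLH hdec (ha ν T hν hT u p ⟨hcl, hext⟩ hLH hdec)

/-- … and hence the crux, VACUOUSLY (no maximal solution survives D4a ∧ D4c) — which is why
"D4a ∧ D4c" is a re-glue of the consumers' `closes`, not a line for this crux (a stub set that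
yields X is summit-strength for a crux-level skeleton). [folklore] -/
theorem noTypeII_of_energyDichotomy (ha : NoEnergyTypeIISingularity)
    (hc : NoEnergyTypeISingularityAtBlowup) : TypeIliouvilleNoTypeII :=
  fun ν T hν hT u p hmax hLH hdec =>
    absurd (ha ν T hν hT u p hmax hLH hdec) (hc ν T hν hT u p hmax hLH hdec)

/-- **Bookkeeping bridge (ν = 1) from the tree's conjecture leaf.**  If every blow-up-time point of a
maximal Leray–Hopf solution (unit viscosity) is energy-Type-I, then — the solution being suitable
weak with weak gradient `∇u` in every backward ball, and SOME point `(T, x₀)` being singular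
(`exists_not_isRegularPoint_of_isMaximalSmoothSolution`, tree) — a local Type-I singular point in
Albritton–Barker's sense exists.  Pure class bookkeeping (classical ⇒ suitable in balls; centred vs
backward cylinders for a function that is junk after `T`); stated, not proved, here. -/
def MaximalEnergyTypeIGivesLocalTypeI : Prop :=
  ∀ (T : ℝ), 0 < T → ∀ (u : ℝ → E3 → E3) (p : ℝ → E3 → ℝ),
    IsMaximalSmoothSolution 1 0 u p T → IsLerayHopfOn T 1 0 (u 0) u →
    HasRapidSpatialDecay (u 0) →
    (∀ x : E3, ∃ r : ℝ, 0 < r ∧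
      typeIBound (parabolicCylinder r (T, x)) u p (fun t y => fderiv ℝ (u t) y) < ⊤) →
    LocalTypeISingularityExists

/-- At unit viscosity, D4c follows from `¬ LocalTypeISingularityExists` (the conclusion the
Liouville routes reach from (L) via `AlbrittonBarkerForward`) and the bookkeeping bridge. [folklore] -/
theorem noEnergyTypeISingularityAtBlowup_unit_of_noLocalTypeI (hno : ¬ LocalTypeISingularityExists)
    (hbk : MaximalEnergyTypeIGivesLocalTypeI) :
    ∀ (T : ℝ), 0 < T → ∀ (u : ℝ → E3 → E3) (p : ℝ → E3 → ℝ),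
      IsMaximalSmoothSolution 1 0 u p T → IsLerayHopfOn T 1 0 (u 0) u →
      HasRapidSpatialDecay (u 0) →
      ¬ (∀ x : E3, ∃ r : ℝ, 0 < r ∧
        typeIBound (parabolicCylinder r (T, x)) u p (fun t y => fderiv ℝ (u t) y) < ⊤) :=
  fun T hT u p hmax hLH hdec hall => hno (hbk T hT u p hmax hLH hdec hall)

end Summit.NavierStokesRegularity.NavierStokesRegularity.Cruxes.TypeIliouvilleNoTypeII.Strategist

end
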